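import Summits.BirchSwinnertonDyer.Rank1Residual.ManinAdditive.PlusIndexLaws
import Literature.NumberTheory.EllipticCurves.EichlerIntegralFrickeProofs
import Literature.NumberTheory.EllipticCurves.AtkinLehnerInvolutions
import Literature.NumberTheory.EllipticCurves.KuriharaNumberParityProofs
import Literature.NumberTheory.EllipticCurves.PeriodLatticeGamma1QuotientProofs
import HarnessLib

/-!
# THE SHIMURA INDEX `[Λ₀(f) : Λ₁(f)]` and THEOREM F (the Fricke lattice law `(1 + ε) Λ₀(f) ⊆ Λ₁(f)`, PROVED) — E-es-70
# (cell `bsd-f2-manin`; part 1/2 of the conjecture leaf typed by the typer g13 from planner es g20's Sketch-es-g20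
# 845cdde0b49804cc, §1–§2 VERBATIM, T-es-25; part 2/2 = `ShimuraIndexSignLaws.lean` (§3–§5); namespace `BsdF2ManinEsG20` →
# `…ManinAdditive.KatoCurve`, es's home namespace; split only because of the 400-line cap on theorem files)

TYPER FRAMING.  Laws are `@[conjecture] def … : Prop` obligations (E-es-70, E-es-71, E-es-71♮: THEOREMS on paper, MEMO-es
§33.2/§33.4, typed as laws until a prover lands them; E-es-72, E-es-72♮, E-es-67♯₂₇: empirical, census E44a–c); THEOREM F
`FrickeLatticeLaw` is a named statement WITH its proof `frickeLatticeLaw_holds` in this file; every `theorem` is kernel-checked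
from landed tree facts (`eichlerIntegral_smul_sub_holds`, `IsFrickeEigen.eichlerIntegral_frickeGL_smul`, `cuspSymbol_mul_holds`,
`totient_mul_mem_periodLatticeGamma1`, `plusIndexPrimeTo_of_natMul_mem`, `IsNewformOf.isFrickeEigen_neg_rootNumber`).
REF1 R-es-39 / REF2 P-es-13 are pending at typing time; their by-name verdicts will be folded at the next substantive touch
(repairs under NEW names).  bears_on: stmt-BirchSwinnertonDyer-22968 (C3 `ManinPrimeToThreeAtNine`: the μ₃-residue of stub 5 /
E-es-61 via E-es-66).  TURNKEY-es-11 (for the C3 LEAD): on the μ₃-residue cut use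
`plusIndexPrimeToThreeOfMuThreeNoRationalThreeTorsion_of_laws hCH hS h27`; on root number `−1` use
`threeAdicPolarWitness_of_rootNumber_eq_neg_one h66`.  Nothing asserted beyond PROVED theorems.

# Sketch-es-g20 (cell `bsd-f2-manin`, Euler-system / explicit-reciprocity lens, gen 20; MEMO-es §33)

THE μ₃-RESIDUE OF STUB 5 THROUGH THE MOD-`p` PLUS FUNCTIONAL.  Objects: `Λ₀(f) = periodLattice f`,
`Λ₁(f) = periodLatticeGamma1 f`, the plus index `PlusIndexPrimeTo p f` (tree, E-es-66's hypothesis), and the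
new `ShimuraIndexPrimeTo p f` («`Λ₀/Λ₁` has no element of order `p`», i.e. `p ∤ [Λ₀ : Λ₁] = #(E₀ ∩ Σ(N))`).

§1  `ShimuraIndexPrimeTo`; PROVED `plusIndexPrimeTo_of_shimuraIndexPrimeTo` (`p ∤ [Λ₀:Λ₁] ⟹ PlusIndexPrimeTo p f`,
    all `f`, via the tree's `φ(N) Λ₀ ⊆ Λ₁`); **E-es-70** `ShimuraIndexPrimeToOfPlusIndex` = the converse (THEOREM Φ′
    on paper: for odd `p` every surjection `Λ₀ ↠ ℤ/p` killing `Λ₁` is `± (2 re / Ω⁺ mod p)`; the `p`-part of `Λ₀/Λ₁`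
    is cyclic).  LAW in Lean (typed), THEOREM on paper (MEMO-es §33.2); NOT used by the chain §5.
§2  **THEOREM F** `FrickeLatticeLaw`: `IsFrickeEigen N f ε ⟹ (1 + ε) Λ₀(f) ⊆ Λ₁(f)` — PROVED here from the
    tree's `eichlerIntegral_smul_sub_holds`, `IsFrickeEigen.eichlerIntegral_frickeGL_smul`, `cuspSymbol_mul_holds`
    (`γ' = w_N γ w_N⁻¹ ∈ Γ₀(N)`, `γ γ' ∈ Γ₁(N)`, `{∞, γ'∞} = ε {∞, γ∞}`).  COR (PROVED): `ε = +1` (root number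
    `−1`) ⟹ `PlusIndexPrimeTo p f` for every odd prime `p` — the ROOT-NUMBER SIEVE for E-es-66/67.
§3  **E-es-71** `AtkinLehnerShimuraSignLaw` + **E-es-71♮** `ShimuraCharacterSupportLaw` (THEOREM AL on paper:
    `p ∣ [Λ₀:Λ₁]`, `p` odd ⟹ EXACTLY ONE `Q ∥ N` has Atkin–Lehner sign `−1`, and the Shimura character lives on
    it).  LAWS in Lean, THEOREM on paper (MEMO-es §33.4).
§4  **E-es-72** `MuThreeOptimalSignAtNine` / **E-es-72♮** `ThreeTorsionOptimalSignAtNine` (the SIGN LAW, NEW,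
    empirical: optimal `W`, `9 ∥ N`, `W[3]` reducible ⟹ `ε₉(f) = w₃(W) = −1` iff `μ₃ ⊂ W`, `= +1` iff `W(ℚ)[3] ≠ 0`;
    E44b: 1 788 / 1 788 and 662 / 662, `N = 9M < 10⁵`, `M` squarefree; E44c: ⟺ Kodaira `I₀*`/`Iₙ*` vs `III` at 3).
§5  THE CHAIN (PROVED): E-es-71♮ ∧ E-es-72 ⟹ E-es-67♯ on `9 ∥ N` (two LAW inputs only); with the residual LAW
    **E-es-67♯₂₇** (`27 ∣ N`; E44a residue: 58 classes `< 10⁵`, all of type R1) ⟹ E-es-67♯ itself.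
Nothing here is asserted: laws are `def … : Prop`; every `theorem` is kernel-checked.  PARTITION 0.
BSD is not proved by this; Manin's conjecture is not proved by this.
-/

noncomputable section

open scoped Classical MatrixGroups ModularForm ComplexConjugate

open CongruenceSubgroup Complex WeierstrassCurve UpperHalfPlane Literature.NumberTheory.EllipticCurves
  Literature.NumberTheory.EllipticCurves.ModularForms

namespace Summit.BirchSwinnertonDyer.Rank1Residual.ManinAdditive.KatoCurve

open Summit.BirchSwinnertonDyer.Rank1Residual.ManinAdditive.CuspidalKummer
  Summit.BirchSwinnertonDyer.Rank1Residual.ManinAdditive.CuspidalKummerThree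

/-! ### §1. The Shimura index and THEOREM Φ′ (E-es-70) -/

/-- `p ∤ [Λ₀(f) : Λ₁(f)]`: the quotient `Λ₀(f)/Λ₁(f)` (the Pontryagin dual of `E₀ ∩ Σ(N)` for an optimal
quotient — Vatsal 2005 Rem. 1.8) has no element of order `p`. -/
def ShimuraIndexPrimeTo (p : ℕ) {N : ℕ} (f : CuspForm (Gamma0 N) 2) : Prop :=
  ∀ x ∈ periodLattice f, (p : ℂ) * x ∈ periodLatticeGamma1 f → x ∈ periodLatticeGamma1 f

/-- `p^a m · x ∈ Λ₁ ⟹ m · x ∈ Λ₁` when `Λ₀/Λ₁` has no `p`-torsion (PROVED). -/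
theorem natMul_mem_of_shimuraIndexPrimeTo {p : ℕ} {N : ℕ} {f : CuspForm (Gamma0 N) 2}
    (h : ShimuraIndexPrimeTo p f) {x : ℂ} (hx : x ∈ periodLattice f) (a m : ℕ)
    (hm : ((p ^ a * m : ℕ) : ℂ) * x ∈ periodLatticeGamma1 f) : (m : ℂ) * x ∈ periodLatticeGamma1 f := by
  induction a with
  | zero => simpa using hm
  | succ a ih =>
    apply ih
    apply h
    · have := (periodLattice f).nsmul_mem hx (p ^ a * m)
      simpa [nsmul_eq_mul] using this
    · convert hm using 1
      push_cast
      ring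

/-- **Shimura index prime to `p` ⟹ plus index prime to `p`** (PROVED, every `f ∈ S₂(Γ₀(N))`, every prime `p`):
`φ(N) Λ₀ ⊆ Λ₁` (tree `totient_mul_mem_periodLatticeGamma1`, Ling–Oesterlé §1), strip the `p`-part of `φ(N)`
using the no-`p`-torsion hypothesis, and feed the prime-to-`p` multiplier to `plusIndexPrimeTo_of_natMul_mem`.
This is the ONLY direction the chain §5 uses. -/
theorem plusIndexPrimeTo_of_shimuraIndexPrimeTo {p : ℕ} (hp : p.Prime) {N : ℕ} [NeZero N]
    (f : CuspForm (Gamma0 N) 2) (h : ShimuraIndexPrimeTo p f) : PlusIndexPrimeTo p f := by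
  have hn : Nat.totient N ≠ 0 := (Nat.totient_pos.mpr (NeZero.pos N)).ne'
  obtain ⟨a, m, hndvd, hnm⟩ := Nat.exists_eq_pow_mul_and_not_dvd hn p hp.one_lt.ne'
  refine plusIndexPrimeTo_of_natMul_mem hndvd f fun w hw => ?_
  refine natMul_mem_of_shimuraIndexPrimeTo h hw a m ?_
  rw [← hnm]
  exact totient_mul_mem_periodLatticeGamma1 f hw

/-- **E-es-70** `ShimuraIndexPrimeToOfPlusIndex` (THEOREM Φ′, es g20; paper proof MEMO-es §33.2, typed as a law —
the converse of `plusIndexPrimeTo_of_shimuraIndexPrimeTo`): for the newform of an elliptic curve (real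
coefficients, `Λ₀(f)` conjugation-stable) and an odd prime `p`, plus index prime to `p` ⟹ `p ∤ [Λ₀ : Λ₁]`.
Mechanism: a surjection `ϑ : Λ₀ ↠ ℤ/p` vanishing on `Λ₁` factors through `d mod N` on `Γ₀(N)` (tree
`cuspSymbol_sub_mem_periodLatticeGamma1_of_apply_eq`), and `d` is invariant under `γ ↦ JγJ` (complex
conjugation on `X₀(N)`), so `ϑ ∘ conj = ϑ`; conj has determinant `−1` on `Λ₀`, so `ϑ` kills its `−1`-eigenline
`= ker (2re/Ω⁺ mod p)` (LEMMA Φ) and `ϑ = ±(2 re/Ω⁺ mod p)`; hence the `p`-part of `Λ₀/Λ₁` is CYCLIC and is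
seen by the plus functional.  Makes E-es-67♯ ⟺ «`3 ∤ #(W ∩ Σ(N))`» (imc's «no 3-gain»).  NOT used by §5. -/
@[conjecture]
def ShimuraIndexPrimeToOfPlusIndex : Prop :=
  ∀ (W : WeierstrassCurve ℚ) [W.IsElliptic] [W.IsGloballyMinimal] {N : ℕ} [NeZero N]
    (D : ModularParametrizationData W N) (p : ℕ), p.Prime → p ≠ 2 →
    PlusIndexPrimeTo p D.f → ShimuraIndexPrimeTo p D.f

/-- The equivalence (PROVED from E-es-70 and the proved half). -/
theorem plusIndexPrimeTo_iff_shimuraIndexPrimeTo (h70 : ShimuraIndexPrimeToOfPlusIndex)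
    (W : WeierstrassCurve ℚ) [W.IsElliptic] [W.IsGloballyMinimal] {N : ℕ} [NeZero N]
    (D : ModularParametrizationData W N) {p : ℕ} (hp : p.Prime) (hp2 : p ≠ 2) :
    PlusIndexPrimeTo p D.f ↔ ShimuraIndexPrimeTo p D.f :=
  ⟨h70 W D p hp hp2, plusIndexPrimeTo_of_shimuraIndexPrimeTo hp D.f⟩

/-! ### §2. THEOREM F — the Fricke lattice law `(1 + ε) Λ₀(f) ⊆ Λ₁(f)` (PROVED) -/

/-- THEOREM F as a named statement. -/
def FrickeLatticeLaw : Prop :=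
  ∀ (N : ℕ) [NeZero N] (f : CuspForm (Gamma0 N) 2) (ε : ℂ), IsFrickeEigen N f ε →
    ∀ x ∈ periodLattice f, (1 + ε) * x ∈ periodLatticeGamma1 f

/-- `uτ + v ≠ 0` on `ℍ` for integers `(u, v) ≠ (0, 0)`. -/
theorem intLinear_ne_zero (τ : ℍ) {u v : ℤ} (h : u ≠ 0 ∨ v ≠ 0) : (u : ℂ) * (τ : ℂ) + v ≠ 0 := by
  intro h0
  have him := congrArg Complex.im h0
  simp only [Complex.add_im, Complex.mul_im, Complex.intCast_re, Complex.intCast_im, zero_mul, add_zero,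
    UpperHalfPlane.coe_im, UpperHalfPlane.coe_re, Complex.zero_im] at him
  have hu : u = 0 := by
    have : (u : ℝ) = 0 := by
      rcases mul_eq_zero.mp him with h1 | h1
      · exact h1
      · exact absurd h1 τ.im_pos.ne'
    exact_mod_cast this
  have hre := congrArg Complex.re h0
  simp only [hu, Int.cast_zero, zero_mul, zero_add, Complex.intCast_re, Complex.zero_re] at hre
  have hv : v = 0 := by exact_mod_cast hre
  rcases h with h | h
  · exact h hu
  · exact h hv

section Fricke

variable {N : ℕ} [NeZero N]

/-- `w_N (γ τ) = γ' (w_N τ)` on `ℍ` for `γ = (a b; c d)`, `γ' = (d, −c/N; −bN, a)` (`w_N γ w_N⁻¹ = γ'`). -/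
theorem frickeGL_smul_sl_smul (γ γ' : SL(2, ℤ)) (h00 : (γ' 0 0 : ℤ) = γ 1 1)
    (h01 : (γ' 0 1 : ℤ) * N = -(γ 1 0)) (h10 : (γ' 1 0 : ℤ) = -(γ 0 1 * N)) (h11 : (γ' 1 1 : ℤ) = γ 0 0)
    (τ : ℍ) :
    glCast (frickeGL N : GL (Fin 2) ℚ) • (γ • τ) = γ' • (glCast (frickeGL N : GL (Fin 2) ℚ) • τ) := by
  have hτ : (τ : ℂ) ≠ 0 := τ.ne_zero
  have hN : (N : ℂ) ≠ 0 := by exact_mod_cast NeZero.ne N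
  have hdet : (γ 0 0 : ℤ) * γ 1 1 - γ 0 1 * γ 1 0 = 1 := by
    have := γ.2; rwa [Matrix.det_fin_two] at this
  have hab : (γ 0 0 : ℤ) ≠ 0 ∨ (γ 0 1 : ℤ) ≠ 0 := by
    by_contra h; push Not at h; rw [h.1, h.2] at hdet; simp at hdet
  have hcd : (γ 1 0 : ℤ) ≠ 0 ∨ (γ 1 1 : ℤ) ≠ 0 := by
    by_contra h; push Not at h; rw [h.1, h.2] at hdet; simp at hdet
  have hnum := intLinear_ne_zero τ hab
  have hden := intLinear_ne_zero τ hcd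
  have hwz : ((glCast (frickeGL N : GL (Fin 2) ℚ) • τ : ℍ) : ℂ) = -((N : ℂ) * τ)⁻¹ := coe_frickeGL_smul N τ
  apply UpperHalfPlane.ext
  rw [coe_frickeGL_smul, coe_specialLinearGroup_apply, coe_specialLinearGroup_apply, hwz]
  simp only [eq_intCast]
  have e00 : ((γ' 0 0 : ℤ) : ℂ) = ((γ 1 1 : ℤ) : ℂ) := by exact_mod_cast h00
  have e01 : ((γ' 0 1 : ℤ) : ℂ) * (N : ℂ) = -((γ 1 0 : ℤ) : ℂ) := by exact_mod_cast h01
  have e10 : ((γ' 1 0 : ℤ) : ℂ) = -(((γ 0 1 : ℤ) : ℂ) * (N : ℂ)) := by exact_mod_cast h10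
  have e11 : ((γ' 1 1 : ℤ) : ℂ) = ((γ 0 0 : ℤ) : ℂ) := by exact_mod_cast h11
  push_cast
  rw [e00, e10, e11]
  have e01' : ((γ' 0 1 : ℤ) : ℂ) = -((γ 1 0 : ℤ) : ℂ) / (N : ℂ) := by
    rw [eq_div_iff hN]; exact e01
  rw [e01']
  have hw1 : -(((γ 0 1 : ℤ) : ℂ) * (N : ℂ)) * -((N : ℂ) * (τ : ℂ))⁻¹ + ((γ 0 0 : ℤ) : ℂ) =
      (((γ 0 0 : ℤ) : ℂ) * (τ : ℂ) + ((γ 0 1 : ℤ) : ℂ)) / (τ : ℂ) := by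
    field_simp
    ring
  have hw2 : ((γ 1 1 : ℤ) : ℂ) * -((N : ℂ) * (τ : ℂ))⁻¹ + -((γ 1 0 : ℤ) : ℂ) / (N : ℂ) =
      -(((γ 1 0 : ℤ) : ℂ) * (τ : ℂ) + ((γ 1 1 : ℤ) : ℂ)) / ((N : ℂ) * (τ : ℂ)) := by
    field_simp
    ring
  rw [hw1, hw2]
  generalize hA : ((γ 0 0 : ℤ) : ℂ) * (τ : ℂ) + ((γ 0 1 : ℤ) : ℂ) = A at hnum ⊢
  generalize hB : ((γ 1 0 : ℤ) : ℂ) * (τ : ℂ) + ((γ 1 1 : ℤ) : ℂ) = B at hden ⊢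
  field_simp

/-- The conjugate `γ' = w_N γ w_N⁻¹` of `γ ∈ Γ₀(N)`: entries `(d, −c/N; −bN, a)`; it lies in `Γ₀(N)`,
`γ γ' ∈ Γ₁(N)`, and `w_N ∘ γ = γ' ∘ w_N` on `ℍ`. -/
theorem exists_frickeConj (γ : Gamma0 N) :
    ∃ γ' : SL(2, ℤ), γ' ∈ Gamma0 N ∧ (γ : SL(2, ℤ)) * γ' ∈ Gamma1 N ∧
      ∀ τ : ℍ, glCast (frickeGL N : GL (Fin 2) ℚ) • ((γ : SL(2, ℤ)) • τ) =
        γ' • (glCast (frickeGL N : GL (Fin 2) ℚ) • τ) := by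
  set g : SL(2, ℤ) := (γ : SL(2, ℤ)) with hg
  have hc : (((g 1 0 : ℤ) : ZMod N)) = 0 := Gamma0_mem.mp γ.2
  obtain ⟨c₀, hc₀⟩ := (ZMod.intCast_zmod_eq_zero_iff_dvd _ N).mp hc
  have hdet : (g 0 0 : ℤ) * g 1 1 - g 0 1 * g 1 0 = 1 := by
    have := g.2; rwa [Matrix.det_fin_two] at this
  let M : Matrix (Fin 2) (Fin 2) ℤ := !![g 1 1, -c₀; -(g 0 1 * N), g 0 0]
  have hM : M.det = 1 := by
    rw [Matrix.det_fin_two_of]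
    linear_combination (g 0 1 : ℤ) * hc₀ + hdet
  refine ⟨⟨M, hM⟩, ?_, ?_, ?_⟩
  · -- `γ' ∈ Γ₀(N)`: lower-left entry `-bN ≡ 0`
    rw [Gamma0_mem]
    show (((-(g 0 1 * (N : ℤ)) : ℤ) : ZMod N)) = 0
    push_cast
    simp
  · -- `γ γ' ∈ Γ₁(N)`
    rw [Gamma1_mem]
    have h00 : ((g * ⟨M, hM⟩ : SL(2, ℤ)) 0 0 : ℤ) = g 0 0 * g 1 1 + g 0 1 * (-(g 0 1 * N)) := by
      simp [M, Matrix.mul_apply, Fin.sum_univ_two]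
    have h11 : ((g * ⟨M, hM⟩ : SL(2, ℤ)) 1 1 : ℤ) = g 1 0 * (-c₀) + g 1 1 * g 0 0 := by
      simp [M, Matrix.mul_apply, Fin.sum_univ_two]
    have h10 : ((g * ⟨M, hM⟩ : SL(2, ℤ)) 1 0 : ℤ) = g 1 0 * g 1 1 + g 1 1 * (-(g 0 1 * N)) := by
      simp [M, Matrix.mul_apply, Fin.sum_univ_two]
    have hN0 : (N : ZMod N) = 0 := ZMod.natCast_self N
    have hdet' := congrArg (fun z : ℤ => (z : ZMod N)) hdet
    have hc₀' := congrArg (fun z : ℤ => (z : ZMod N)) hc₀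
    push_cast at hdet' hc₀'
    refine ⟨?_, ?_, ?_⟩
    · rw [h00]; push_cast
      linear_combination hdet' + ((g 0 1 : ℤ) : ZMod N) * hc₀'
        + (((g 0 1 : ℤ) : ZMod N) * ((c₀ : ZMod N) - ((g 0 1 : ℤ) : ZMod N))) * hN0
    · rw [h11]; push_cast
      linear_combination hdet' + (((g 0 1 : ℤ) : ZMod N) - (c₀ : ZMod N)) * hc₀'
        + ((c₀ : ZMod N) * (((g 0 1 : ℤ) : ZMod N) - (c₀ : ZMod N))) * hN0
    · rw [h10]; push_cast
      linear_combination ((g 1 1 : ℤ) : ZMod N) * hc₀'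
        + (((g 1 1 : ℤ) : ZMod N) * ((c₀ : ZMod N) - ((g 0 1 : ℤ) : ZMod N))) * hN0
  · intro τ
    refine frickeGL_smul_sl_smul g ⟨M, hM⟩ rfl ?_ ?_ rfl τ
    · show (-c₀) * (N : ℤ) = -(g 1 0 : ℤ)
      rw [hc₀]; ring
    · rfl

/-- **THEOREM F on generators**: `{∞, γ'∞}_f = ε {∞, γ∞}_f` and `(1 + ε) {∞, γ∞}_f = {∞, γγ' ∞}_f ∈ Λ₁(f)`. -/
theorem one_add_mul_cuspSymbol_mem_periodLatticeGamma1 (f : CuspForm (Gamma0 N) 2) {ε : ℂ}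
    (hW : IsFrickeEigen N f ε) (γ : Gamma0 N) :
    (1 + ε) * cuspSymbol f γ ∈ periodLatticeGamma1 f := by
  obtain ⟨γ', hγ', hprod, hpt⟩ := exists_frickeConj γ
  set τ₀ : ℍ := UpperHalfPlane.I
  set W := glCast (frickeGL N : GL (Fin 2) ℚ)
  have h1 := eichlerIntegral_smul_sub_holds f ⟨γ', hγ'⟩ (W • τ₀)
  have h2 := eichlerIntegral_smul_sub_holds f γ τ₀
  have h3 := hW.eichlerIntegral_frickeGL_smul ((γ : SL(2, ℤ)) • τ₀)
  have h4 := hW.eichlerIntegral_frickeGL_smul τ₀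
  have h1' : eichlerIntegral f (W • ((γ : SL(2, ℤ)) • τ₀)) - eichlerIntegral f (W • τ₀) =
      cuspSymbol f ⟨γ', hγ'⟩ := by
    rw [hpt τ₀]; exact h1
  have key : cuspSymbol f ⟨γ', hγ'⟩ = ε * cuspSymbol f γ := by
    linear_combination (-1 : ℂ) * h1' + h3 - h4 + ε * h2
  have hmul := cuspSymbol_mul_holds f γ ⟨γ', hγ'⟩
  have hmem : cuspSymbol f (γ * ⟨γ', hγ'⟩) ∈ periodLatticeGamma1 f :=
    cuspSymbol_mem_periodLatticeGamma1 f ⟨(γ : SL(2, ℤ)) * γ', hprod⟩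
  rw [hmul, key] at hmem
  convert hmem using 1
  ring

/-- **THEOREM F** (PROVED): `IsFrickeEigen N f ε ⟹ (1 + ε) Λ₀(f) ⊆ Λ₁(f)` (closure induction). -/
theorem frickeLatticeLaw_holds : FrickeLatticeLaw := by
  intro N _ f ε hW x hx
  induction hx using AddSubgroup.closure_induction with
  | mem x hx =>
    obtain ⟨γ, rfl⟩ := hx
    exact one_add_mul_cuspSymbol_mem_periodLatticeGamma1 f hW γ
  | zero => rw [mul_zero]; exact zero_mem _
  | add x y _ _ hx hy => rw [mul_add]; exact add_mem hx hy
  | neg x _ hx => rw [mul_neg]; exact neg_mem hx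

/-- **ROOT-NUMBER SIEVE** (PROVED): Fricke sign `+1` (root number `−1`, every odd-analytic-rank class) ⟹
`2 Λ₀(f) ⊆ Λ₁(f)` ⟹ the plus index is prime to every odd prime. -/
theorem plusIndexPrimeTo_of_frickePlus (f : CuspForm (Gamma0 N) 2) (hW : IsFrickeEigen N f 1) {p : ℕ}
    (hp : p.Prime) (hp2 : p ≠ 2) : PlusIndexPrimeTo p f := by
  refine plusIndexPrimeTo_of_natMul_mem (p := p) (k := 2) ?_ f fun w hw => ?_
  · intro h
    exact hp2 ((Nat.prime_dvd_prime_iff_eq hp Nat.prime_two).mp h).symm.symm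
  · have := frickeLatticeLaw_holds N f 1 hW w hw
    convert this using 1
    push_cast; ring

/-- The same for the Shimura index: Fricke sign `+1` ⟹ `Λ₀/Λ₁` has no odd torsion (PROVED). -/
theorem shimuraIndexPrimeTo_of_frickePlus (f : CuspForm (Gamma0 N) 2) (hW : IsFrickeEigen N f 1) {p : ℕ}
    (hp : p.Prime) (hp2 : p ≠ 2) : ShimuraIndexPrimeTo p f := by
  intro x hx hpx
  have h2 : (2 : ℂ) * x ∈ periodLatticeGamma1 f := by
    have := frickeLatticeLaw_holds N f 1 hW x hx
    convert this using 1; ring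
  -- `p` odd: `1 = a p + b 2` over `ℤ`
  have hcop : Nat.Coprime p 2 := (Nat.coprime_primes hp Nat.prime_two).mpr hp2
  obtain ⟨a, b, hab⟩ := Nat.isCoprime_iff_coprime.mpr hcop
  push_cast at hab
  have hx' : x = (a : ℂ) * ((p : ℂ) * x) + (b : ℂ) * (2 * x) := by
    have h1 : (a : ℂ) * p + (b : ℂ) * 2 = 1 := by exact_mod_cast hab
    linear_combination (-x) * h1
  have ha : (a : ℂ) * ((p : ℂ) * x) ∈ periodLatticeGamma1 f := by
    have := AddSubgroup.zsmul_mem (periodLatticeGamma1 f) hpx a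
    simpa [zsmul_eq_mul] using this
  have hb : (b : ℂ) * (2 * x) ∈ periodLatticeGamma1 f := by
    have := AddSubgroup.zsmul_mem (periodLatticeGamma1 f) h2 b
    simpa [zsmul_eq_mul] using this
  rw [hx']
  exact add_mem ha hb

/-- **ROOT NUMBER `−1` ⟹ plus index prime to every odd `p`** (PROVED, unconditional; the root number is
read through the tree's `IsNewformOf.isFrickeEigen_neg_rootNumber`, Atkin–Lehner 1970 Thm. 3): for any
`X₀(N_W)`-datum of a curve of root number `−1` — in particular every curve of odd analytic rank — E-es-66's
hypothesis holds.  No optimality, no `μ₃`, no torsion hypothesis. -/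
theorem plusIndexPrimeTo_of_rootNumber_eq_neg_one (W : WeierstrassCurve ℚ) [W.IsElliptic]
    [W.IsGloballyMinimal] [NeZero (W.conductorNorm ℤ)] (D : ModularParametrizationData W (W.conductorNorm ℤ))
    (hw : W.rootNumber = -1) {p : ℕ} (hp : p.Prime) (hp2 : p ≠ 2) : PlusIndexPrimeTo p D.f := by
  have h := D.isNewformOf.isFrickeEigen_neg_rootNumber
  rw [hw] at h
  push_cast at h
  rw [neg_neg] at h
  exact plusIndexPrimeTo_of_frickePlus D.f h hp hp2

end Fricke

end Summit.BirchSwinnertonDyer.Rank1Residual.ManinAdditive.KatoCurve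

end
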